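import Literature.AlgebraicGeometry.Motives.ProjectiveSpaceLinearSubspaceSection
import HarnessLib

/-!
# The section of a linear subspace of `ℙᴺ` by a hypersurface meeting it in a hyperplane of it

A variant of `ProjSpace.exists_primeInter_formDivisor_eq_smul_of_isLinearSubspacePoint`
(`Motives/ProjectiveSpaceLinearSubspaceSection`: a hyperplane section of an `r`-plane is a positive
multiple of an `(r-1)`-plane) for a form `F` of any degree `e ≥ 1` whose zero set meets the `r`-plane
`Π = closure {w}` set-theoretically in the `(r-1)`-plane `Π ∩ V₊(ℓ)`, `ℓ` a linear form with
`Π ⊄ V₊(ℓ)`: then the cycle `V₊(F) · [Π]` (`CartierDivisor.primeInter` of `ProjSpace.formDivisor F`,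
Fulton Def. 2.3) is `a • [Π ∩ V₊(ℓ)]` with `a ≥ 1`:

* `ProjSpace.exists_primeInter_formDivisor_eq_smul_of_zeroLocus_inter_eq`.

This is the cycle-level content of "Γ · Y = d W" for a STRONG plane in Hirschowitz–Iyer, Contemp.
Math. 522 (2010), §2, proof of Lemma 2.2, case `s = r` ("`W` is a strong `r`-plane … a strong
`(r+1)`-plane in `Y'` which we take for `Γ`. Indeed, we have `Γ · Y = dW`"), in the amount used
there (positivity of the multiple). The proof is that of the linear case verbatim (effective cycle
supported on `Π ∩ V₊(F) = Π ∩ V₊(ℓ)`, positive order of a non-unit local equation at the generic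
point of the `(r-1)`-plane).

Everything is proved; no named facts.

## References

* A. Hirschowitz, J. N. Iyer, Contemp. Math. 522 (2010), §2, Lemma 2.2. [HirschowitzIyer2010]
* W. Fulton, *Intersection Theory*, 2nd ed. (1998), Def. 2.3 (p. 33). [Fulton1998]
-/

noncomputable section

universe u

open CategoryTheory AlgebraicGeometry Order Topology TopologicalSpace
open MvPolynomial (X C)
open Literature.AlgebraicGeometry.Motives.Segre Literature.AlgebraicGeometry.Motives.RatFn

attribute [local instance] MvPolynomial.gradedAlgebra

namespace Literature.AlgebraicGeometry.Motives

namespace ProjSpace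

variable {N : ℕ} {K : Type u} [Field K]

/-- **The section of an `r`-plane `Π ⊆ ℙᴺ` by a hypersurface `V₊(F)` with `Π ∩ V₊(F) = Π ∩ V₊(ℓ)`
set-theoretically** (`ℓ` linear, `Π ⊄ V₊(ℓ)`): `V₊(F) · [Π] = a • [Π ∩ V₊(ℓ)]` for an integer `a ≥ 1`
and the `(r-1)`-plane `Π ∩ V₊(ℓ)` (Hirschowitz–Iyer, Lemma 2.2, case `s = r`: "`Γ · Y = d W`" for a
strong plane `Γ`; here only `a > 0`). [cite: HirschowitzIyer2010, §2 Lemma 2.2 (case s = r)] -/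
theorem exists_primeInter_formDivisor_eq_smul_of_zeroLocus_inter_eq {r : ℕ} (hr : 1 ≤ r)
    {w : ↥(projectiveSpace N K).left} (hw : IsLinearSubspacePoint r N (𝟙 (projectiveSpace N K)) w)
    {ℓ : MvPolynomial (Fin (N + 1)) K} (hℓ : ℓ ∈ grading (Fin (N + 1)) K 1)
    (hℓw : ℓ ∉ (ProjectiveSpectrum.asHomogeneousIdeal
      (𝒜 := MvPolynomial.homogeneousSubmodule (Fin (N + 1)) K) w))
    {e : ℕ} (he : 0 < e) {F : MvPolynomial (Fin (N + 1)) K} (hF : F ∈ grading (Fin (N + 1)) K e)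
    (hF0 : F ≠ 0)
    (hFℓ : closure {w} ∩ ProjectiveSpectrum.zeroLocus (MvPolynomial.homogeneousSubmodule (Fin (N + 1)) K) {F} =
      closure {w} ∩ ProjectiveSpectrum.zeroLocus (MvPolynomial.homogeneousSubmodule (Fin (N + 1)) K) {ℓ}) :
    ∃ (w' : ↥(projectiveSpace N K).left) (a : ℤ), IsLinearSubspacePoint (r - 1) N (𝟙 (projectiveSpace N K)) w' ∧
      0 < a ∧ (formDivisor F hF hF0).primeInter (X := projectiveSpace N K) w = a • primeCycle w' ∧
      closure {w'} = closure {w} ∩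
        ProjectiveSpectrum.zeroLocus (MvPolynomial.homogeneousSubmodule (Fin (N + 1)) K) {ℓ} := by
  classical
  obtain ⟨L, hL, hhom, hcl, hspan, hrN⟩ := hw.exists_eq_span_of_id
  have hht : height w = r := hw.1
  -- the `(r-1)`-plane `Π' = V₊(L, ℓ)`
  have hℓspan : ℓ ∉ Submodule.span K (Set.range L) := by
    intro h
    apply hℓw
    have h' : ℓ ∈ Ideal.span (Set.range L) := by
      have hle : Submodule.span K (Set.range L) ≤ (Ideal.span (Set.range L)).restrictScalars K :=
        Submodule.span_le.mpr Ideal.subset_span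
      exact hle h
    change ℓ ∈ (ProjectiveSpectrum.asHomogeneousIdeal
      (𝒜 := MvPolynomial.homogeneousSubmodule (Fin (N + 1)) K) w).toIdeal
    rw [hspan]
    exact h'
  set L' : Fin (N - r + 1) → MvPolynomial (Fin (N + 1)) K := Fin.snoc L ℓ with hL'
  have hL'ind : LinearIndependent K L' := linearIndependent_finSnoc.2 ⟨hL, hℓspan⟩
  have hL'hom : ∀ j, (L' j).IsHomogeneous 1 := by
    intro j
    refine Fin.lastCases ?_ (fun i => ?_) j
    · rw [hL', Fin.snoc_last]
      exact (MvPolynomial.mem_homogeneousSubmodule 1 ℓ).1 hℓ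
    · rw [hL', Fin.snoc_castSucc]
      exact hhom i
  have hrange : Set.range L' = insert ℓ (Set.range L) := by
    ext g
    simp only [Set.mem_range, Set.mem_insert_iff]
    constructor
    · rintro ⟨j, rfl⟩
      refine Fin.lastCases ?_ (fun i => ?_) j
      · left; rw [hL', Fin.snoc_last]
      · right; exact ⟨i, by rw [hL', Fin.snoc_castSucc]⟩
    · rintro (rfl | ⟨i, rfl⟩)
      · exact ⟨Fin.last _, by rw [hL', Fin.snoc_last]⟩
      · exact ⟨Fin.castSucc i, by rw [hL', Fin.snoc_castSucc]⟩
  obtain ⟨w', hw'span, hhtw', -⟩ :=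
    exists_point_of_linearIndependent L' hL'ind hL'hom (by omega)
  have hhtw'' : height w' = ((r - 1 : ℕ) : ℕ∞) := by
    rw [hhtw']
    congr 1
    omega
  have hsetw' : ((ProjectiveSpectrum.asHomogeneousIdeal
      (𝒜 := MvPolynomial.homogeneousSubmodule (Fin (N + 1)) K) w' :
        HomogeneousIdeal (MvPolynomial.homogeneousSubmodule (Fin (N + 1)) K)) :
          Set (MvPolynomial (Fin (N + 1)) K)) =
      (Ideal.span (Set.range L') : Set (MvPolynomial (Fin (N + 1)) K)) := by
    rw [← hw'span]
    rfl
  have hclw' : closure {w'} = ProjectiveSpectrum.zeroLocus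
      (MvPolynomial.homogeneousSubmodule (Fin (N + 1)) K) (Set.range L') := by
    rw [closure_singleton_eq_zeroLocus, hsetw', ProjectiveSpectrum.zeroLocus_span]
  -- `Π' = Π ∩ V₊(ℓ)`
  have hclw'2 : closure {w'} = closure {w} ∩ ProjectiveSpectrum.zeroLocus
      (MvPolynomial.homogeneousSubmodule (Fin (N + 1)) K) {ℓ} := by
    rw [hclw', hcl, hrange, Set.insert_eq, ProjectiveSpectrum.zeroLocus_union]
    exact Set.inter_comm _ _
  -- `w'` is an `(r-1)`-plane point (reindex `L'` by `Fin (N - (r - 1)) ≃ Fin (N - r + 1)`)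
  have hcast : N - (r - 1) = N - r + 1 := by omega
  have hw'lin : IsLinearSubspacePoint (r - 1) N (𝟙 (projectiveSpace N K)) w' := by
    refine ⟨hhtw'', fun j => L' (Fin.cast hcast j), ?_, fun j => hL'hom _, ?_⟩
    · exact hL'ind.comp _ (Fin.cast_injective hcast)
    · have hr' : Set.range (fun j => L' (Fin.cast hcast j)) = Set.range L' := by
        ext g
        constructor
        · rintro ⟨j, rfl⟩; exact ⟨_, rfl⟩
        · rintro ⟨j, rfl⟩; exact ⟨Fin.cast hcast.symm j, by simp⟩
      rw [hr']
      change id '' closure {w'} = _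
      rw [Set.image_id, hclw']
  -- `F ∉ 𝔭_w` (else `w ∈ Π ∩ V₊(F) = Π ∩ V₊(ℓ)`)
  have hFw : F ∉ ProjectiveSpectrum.asHomogeneousIdeal
      (𝒜 := MvPolynomial.homogeneousSubmodule (Fin (N + 1)) K) w := by
    intro h
    have hmem : w ∈ closure {w} ∩ ProjectiveSpectrum.zeroLocus
        (MvPolynomial.homogeneousSubmodule (Fin (N + 1)) K) {F} :=
      ⟨subset_closure (Set.mem_singleton w),
        (ProjectiveSpectrum.mem_zeroLocus _ _ _).2 (Set.singleton_subset_iff.2 h)⟩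
    rw [hFℓ] at hmem
    exact hℓw (Set.singleton_subset_iff.1 ((ProjectiveSpectrum.mem_zeroLocus _ _ _).1 hmem.2))
  -- the cycle `V₊(F) · [Π]`
  set H' : CartierDivisor (projectiveSpace N K).left := formDivisor F hF hF0 with hH'
  have hH'e : H'.IsEffective := isEffective_formDivisor hF hF0
  have hH'w : H'.Avoids w := (formDivisor_avoids_iff hF hF0 he).2 hFw
  set γ := H'.primeInter (X := projectiveSpace N K) w with hγ
  have hγd : γ ∈ cyclesOfDim (projectiveSpace N K).left (r - 1) := by
    refine H'.primeInter_mem_cyclesOfDim ?_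
    rw [hht]
    norm_cast
    omega
  -- its support is `{w'}`
  have hsuppt : ∀ x, γ x ≠ 0 → x = w' := by
    intro x hx
    have hwx : w ⤳ x := H'.specializes_of_primeInter_ne_zero hx
    have hFx : F ∈ ProjectiveSpectrum.asHomogeneousIdeal
        (𝒜 := MvPolynomial.homogeneousSubmodule (Fin (N + 1)) K) x := by
      by_contra h
      exact H'.not_avoids_of_primeInter_ne_zero hx ((formDivisor_avoids_iff hF hF0 he).2 h)
    have hxw' : x ∈ closure {w'} := by
      rw [hclw'2, ← hFℓ]
      exact ⟨hwx.mem_closure, (ProjectiveSpectrum.mem_zeroLocus _ _ _).2 (Set.singleton_subset_iff.2 hFx)⟩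
    have hw'x : w' ⤳ x := specializes_iff_mem_closure.2 (by simpa using hxw')
    have hle : x ≤ w' := Scheme.le_iff_specializes.mpr hw'x
    by_cases heq : x = w'
    · exact heq
    · exfalso
      have hlt : x < w' := lt_of_le_not_ge hle fun hge =>
        heq ((hw'x.antisymm (Scheme.le_iff_specializes.mp hge)).eq.symm)
      have h1 := height_add_one_le hlt
      rw [hγd x hx, hhtw''] at h1
      exact absurd h1 (by norm_cast; omega)
  have hγeq : γ = γ w' • primeCycle w' := by
    ext x
    simp only [Function.locallyFinsuppWithin.coe_zsmul, Pi.smul_apply, smul_eq_mul]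
    by_cases hx : x = w'
    · subst hx
      rw [primeCycle_apply_self, mul_one]
    · rw [primeCycle_apply_of_ne hx, mul_zero]
      by_contra h
      exact hx (hsuppt x h)
  -- the coefficient at `w'` is positive
  have hww' : w ⤳ w' := by
    have : w' ∈ closure {w} := by
      have h := (subset_closure (Set.mem_singleton w') : w' ∈ closure {w'})
      rw [hclw'2] at h
      exact h.1
    exact specializes_iff_mem_closure.2 this
  have hpos : 0 < γ w' := by
    rw [hγ, H'.primeInter_apply_of_specializes hww']
    have hH'gen : H'.Avoids ((ClosedSubvariety.ofPoint (projectiveSpace N K).left w).ι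
        (genericPoint (ClosedSubvariety.ofPoint (projectiveSpace N K).left w).carrier)) := by
      change H'.Avoids (ClosedSubvariety.ofPoint (projectiveSpace N K).left w).genericPoint
      rw [ClosedSubvariety.genericPoint_ofPoint]
      exact hH'w
    rw [CartierDivisor.pullbackRep_of_avoids _ _ hH'gen]
    set V := ClosedSubvariety.ofPoint (projectiveSpace N K).left w
    set v : ↥V.carrier := ClosedSubvariety.ofPointPt w hww'
    set E := H'.pullbackAvoiding V.ι hH'gen
    obtain ⟨i, hi⟩ := E.covers v
    -- `F ∈ 𝔭_{w'}` (as `w' ∈ Π ∩ V₊(ℓ) = Π ∩ V₊(F)`): the local equation is not a unit at `v`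
    have hFw' : F ∈ ProjectiveSpectrum.asHomogeneousIdeal
        (𝒜 := MvPolynomial.homogeneousSubmodule (Fin (N + 1)) K) w' := by
      have hmem : w' ∈ closure {w} ∩ ProjectiveSpectrum.zeroLocus
          (MvPolynomial.homogeneousSubmodule (Fin (N + 1)) K) {ℓ} := by
        rw [← hclw'2]
        exact subset_closure (Set.mem_singleton w')
      rw [← hFℓ] at hmem
      exact Set.singleton_subset_iff.1 ((ProjectiveSpectrum.mem_zeroLocus _ _ _).1 hmem.2)
    have hnav : ¬ H'.Avoids w' := fun h =>
      ((formDivisor_avoids_iff hF hF0 he).1 h) hFw'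
    have hu : ¬ IsUnitAt (V.ι v) (H'.f i.1) := by
      intro h
      exact hnav (CartierDivisor.Avoids.of_mem hi h)
    have hu' := (hH'e.not_isUnitAt_pullbackAvoiding V.ι hH'gen i hi hu)
    -- `codim_V v = 1`
    have hcoh : coheight v = 1 := by
      have hsum := Scheme.height_add_coheight_eq_height_top (V.over (projectiveSpace N K).hom).hom v
      change height v + coheight v = height (⊤ : ↥V.carrier) at hsum
      rw [height_top_ofPoint, hht, ← height_base_eq_of_isClosedImmersion' V.ι v] at hsum
      change height w' + coheight v = r at hsum
      rw [hhtw''] at hsum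
      have h1 : ((r - 1 : ℕ) : ℕ∞) + 1 = (r : ℕ∞) := by norm_cast; omega
      rw [← h1] at hsum
      exact WithTop.add_left_cancel (ENat.coe_ne_top _) hsum
    exact (hH'e.pullbackAvoiding V.ι hH'gen).ordAt_pos hi hu' hcoh
  exact ⟨w', γ w', hw'lin, hpos, hγeq, hclw'2⟩

end ProjSpace

end Literature.AlgebraicGeometry.Motives

end
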